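import Literature.Computability.Complexity.MCSPStarFromRedOut
import Literature.Computability.Complexity.HiraharaCoins
import HarnessLib

/-!
# `MCSP*` from a polynomial-time implementation of Hirahara's reduction, II: coin budget discharged

Topic `Computability/Complexity`. The assembly theorems of `MCSPStarFromRedOut.lean` take an
implementation of `HiraharaRed.redOut c` as a string function `F ∈ FP` on pair codes together with
a polynomial coin budget `q` dominating `totCoins`. With the budget bound of `HiraharaCoins.lean`
(`totCoins ≤ coinPoly (|code I₀|)`, `coinPoly = 2^{4096} · 1024 · (X + 1)^5`) the second datum is
fixed once and for all, and what remains of Lemma 8.3 / Thm. 8.5 (`MCSP*` case) is the single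
implementation statement

  `∃ F ∈ FP, ∀ I₀ r, |r| = coinPoly (|code I₀|) → F ⟨code I₀, r⟩ = redOut c I₀ r`.

* `HiraharaRed.Hirahara2022_gapCMMSA_randReducible_MCSPStar_of_FP` — the named fact
  `Hirahara2022_gapCMMSA_randReducible_MCSPStar` from that statement for all `c ≥ 1`;
* `HiraharaRed.isRandNPHard_MCSPStar_of_raz_of_FP` — `isRandNPHard_MCSPStar` from Raz's theorem
  (Arora–Barak 2009, Thm. 22.15, displayed hypothesis) and that statement for `c = 1`;
* `HiraharaRed.isRandNPHard_MCSPStar_of_pcp_of_FP` — from the sliding-scale PCP fact and that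
  statement for all `c ≥ 1`.

## References

* S. Hirahara, *NP-hardness of learning programs and partial MCSP*, ECCC TR22-119, Lemma 8.3
  and the proof of Thm. 8.5 (`MCSP*` case, pp. 30–31) [Hirahara2022PartialMCSP].
* S. Arora, B. Barak, *Computational Complexity: A Modern Approach*, CUP 2009, Def. 7.3, §7.6,
  Thm. 22.15 [AroraBarak2009].
-/

namespace Literature.Computability.Complexity

open _root_.Computability MetaComplexity

namespace HiraharaRed

/-- **The named fact `Hirahara2022_gapCMMSA_randReducible_MCSPStar` from polynomial-time
implementations of `redOut c` (all `c ≥ 1`) reading `coinPoly (|code I₀|)` coins.**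
[cite: Hirahara2022PartialMCSP, Lemma 8.3 and proof of Thm. 8.5 (MCSP* case, pp. 30–31)] -/
theorem Hirahara2022_gapCMMSA_randReducible_MCSPStar_of_FP
    (hF : ∀ c : ℕ, 1 ≤ c → ∃ F ∈ FP, ∀ (I₀ : CMMSAInstance) (r : List Bool),
      r.length = coinPoly.eval (CMMSAInstance.encoding.encode I₀).length →
        F (boolPair (CMMSAInstance.encoding.encode I₀) r) = redOut c I₀ r) :
    Hirahara2022_gapCMMSA_randReducible_MCSPStar :=
  Hirahara2022_gapCMMSA_randReducible_MCSPStar_of_pairFn fun c hc => by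
    obtain ⟨F, hFP, hFq⟩ := hF c hc
    exact ⟨F, hFP, coinPoly, hFq, fun I₀ h => totCoins_toPInst_le_eval I₀ h⟩

/-- **`isRandNPHard_MCSPStar` from Raz's theorem (Arora–Barak 2009, Thm. 22.15) and a
polynomial-time implementation of `redOut 1` reading `coinPoly (|code I₀|)` coins.**
[cite: Hirahara2022PartialMCSP, Thm. 8.5 (proof, pp. 30–31); AroraBarak2009, Thm. 22.15] -/
theorem isRandNPHard_MCSPStar_of_raz_of_FP
    (hraz : ∃ c : ℕ, 1 < c ∧ ∀ t : ℕ, 1 < t → (gapLabelCover (2 ^ (c * t)) (1 / 2 ^ t)).IsNPHard)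
    (hF : ∃ F ∈ FP, ∀ (I₀ : CMMSAInstance) (r : List Bool),
      r.length = coinPoly.eval (CMMSAInstance.encoding.encode I₀).length →
        F (boolPair (CMMSAInstance.encoding.encode I₀) r) = redOut 1 I₀ r) :
    isRandNPHard_MCSPStar := by
  obtain ⟨F, hFP, hFq⟩ := hF
  exact isRandNPHard_MCSPStar_of_raz_of_pairFn hraz
    ⟨F, hFP, coinPoly, hFq, fun I₀ h => totCoins_toPInst_le_eval I₀ h⟩

/-- **`isRandNPHard_MCSPStar` from the sliding-scale PCP fact and polynomial-time implementations
of `redOut c` (all `c ≥ 1`).** [cite: Hirahara2022PartialMCSP, Thm. 8.5 (proof, pp. 30–31) with Thm. 5.2 and Lemma 5.3] -/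
theorem isRandNPHard_MCSPStar_of_pcp_of_FP (h53 : Hirahara2022_lem53_logPow_queried)
    (hF : ∀ c : ℕ, 1 ≤ c → ∃ F ∈ FP, ∀ (I₀ : CMMSAInstance) (r : List Bool),
      r.length = coinPoly.eval (CMMSAInstance.encoding.encode I₀).length →
        F (boolPair (CMMSAInstance.encoding.encode I₀) r) = redOut c I₀ r) :
    isRandNPHard_MCSPStar :=
  isRandNPHard_MCSPStar_of_pcp h53 (Hirahara2022_gapCMMSA_randReducible_MCSPStar_of_FP hF)

end HiraharaRed

end Literature.Computability.Complexity
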